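import Literature.Algebra.EuclideanLattices.LenstraPomeranceCosetBox
import HarnessLib

/-!
# Nearly uniform random elements from random exponent vectors (LP92, Theorem 5.2)

H. W. Lenstra Jr. and C. Pomerance, *A rigorous time bound for factoring integers*,
J. Amer. Math. Soc. **5** (1992) 483–516, §5, **Theorem 5.2** (p. 498):

> Let `Δ` be a negative discriminant, `𝒢` a set of generators of `C_Δ`, and `f ∈ C_Δ`. Then the
> number of vectors `r = (r(g))_{g ∈ 𝒢} ∈ {1, 2, …, |Δ|}^𝒢` satisfying `∏ g^{r(g)} = f` equals
> `(|Δ|^{#𝒢} / #C_Δ) · exp ε` for some real `ε` with `|ε| < #C_Δ / (|Δ| - #C_Δ) < 1`.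

The printed proof applies Lemma 5.1 to `m = #𝒢`, `h = d = #C_Δ`, `b = |Δ|`, `Λ = ker φ` for the
surjection `φ : ℤ^𝒢 → C_Δ`, `r ↦ ∏ g^{r(g)}`, using only that `C_Δ` is a finite abelian group
of order `< |Δ|/2` ((2.3)). We prove exactly this abstract statement
(`preimage_box_count_eq_exp`): for a surjective homomorphism `φ : ℤ^m → C` onto a finite abelian
group of order `h < b` and any `f ∈ C`, `#{r ∈ {1,…,b}^m : φ r = f} = (b^m/h) e^ε` with
`|ε| < h/(b - h)` (so `|ε| < 1` as soon as `2h < b`). Fully proved from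
`LenstraPomeranceCosetBox.coset_box_count_eq_exp`; no definitions, no named facts.
-/

namespace Literature.Algebra.EuclideanLattices
namespace LenstraPomerance

open Finset

/-- For `0 ≤ h` and `0 < B`: `(h - 1)/(B + 1) < h/B` — the comparison behind
`|ε| ≤ (h-1)/(b-h+1) < h/(b-h)` in the proof of Theorem 5.2. [folklore] -/
theorem sub_one_div_lt_div {h B : ℝ} (hh : 0 ≤ h) (hB : 0 < B) : (h - 1) / (B + 1) < h / B := by
  rw [div_lt_div_iff₀ (by linarith) hB]
  nlinarith

/-- **Theorem 5.2 of Lenstra–Pomerance (1992), abstract form.** Let `C` be a finite abelian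
group of order `h`, `φ : ℤ^m →+ C` a surjective homomorphism (e.g. `r ↦ ∑ r(g) · g` for a
generating set of size `m`), `f ∈ C` and `b` a natural number with `h < b`. Then the number of
`r ∈ {1, …, b}^m` with `φ r = f` equals `(b^m / h) · e^ε` for a real `ε` with `|ε| < h / (b - h)`.
(For `C = C_Δ`, `b = |Δ|`, `h = #C_Δ < |Δ|/2` this is the printed statement, with `|ε| < 1`.)
[cite: LenstraPomerance1992, Theorem 5.2] -/
theorem preimage_box_count_eq_exp {m : ℕ} {C : Type*} [AddCommGroup C] [Finite C]
    (φ : (Fin m → ℤ) →+ C) (hφ : Function.Surjective φ) (f : C) {b : ℕ} (hb : Nat.card C < b) :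
    ∃ ε : ℝ, |ε| < Nat.card C / ((b : ℝ) - Nat.card C) ∧
      ({r : Fin m → ℤ | (∀ i, 1 ≤ r i ∧ r i ≤ (b : ℤ)) ∧ φ r = f}.ncard : ℝ)
        = (b : ℝ) ^ m / Nat.card C * Real.exp ε := by
  set h := Nat.card C with hh
  have hpos : 0 < h := Nat.card_pos
  -- the kernel has index `h` and contains `(hℤ)^m`
  have hidx : φ.ker.index = h := by
    rw [AddSubgroup.index_ker, AddMonoidHom.range_eq_top.2 hφ, AddSubgroup.card_top]
  have hker : ∀ i, Pi.single i (h : ℤ) ∈ φ.ker := by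
    intro i
    have hsingle : (Pi.single i (h : ℤ) : Fin m → ℤ) = h • Pi.single i (1 : ℤ) := by
      funext j
      by_cases hj : j = i
      · subst hj; simp
      · simp [hj]
    rw [AddMonoidHom.mem_ker, hsingle, map_nsmul, hh, card_nsmul_eq_zero']
  -- the fibre over `f` is a coset of the kernel
  obtain ⟨c, hc⟩ := hφ f
  have hset : {r : Fin m → ℤ | (∀ i, 1 ≤ r i ∧ r i ≤ (b : ℤ)) ∧ φ r = f}
      = {r : Fin m → ℤ | (∀ i, 1 ≤ r i ∧ r i ≤ (b : ℤ)) ∧ r - c ∈ φ.ker} := by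
    ext r
    simp only [Set.mem_setOf_eq, AddMonoidHom.mem_ker, map_sub, hc, sub_eq_zero]
  obtain ⟨ε, hε, hcount⟩ := coset_box_count_eq_exp φ.ker hpos hb.le hker c
  rw [hidx] at hε hcount
  refine ⟨ε, ?_, by rw [hset, hcount]⟩
  have hhr : (1 : ℝ) ≤ h := by exact_mod_cast hpos
  have hbr : (h : ℝ) < b := by exact_mod_cast hb
  calc |ε| ≤ min ((h : ℝ) - 1) (m * ((h : ℝ) - 1)) / ((b : ℝ) - h + 1) := hε
    _ ≤ ((h : ℝ) - 1) / ((b : ℝ) - h + 1) :=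
        div_le_div_of_nonneg_right (min_le_left _ _) (by linarith)
    _ < h / ((b : ℝ) - h) := sub_one_div_lt_div (by linarith) (by linarith)

end LenstraPomerance
end Literature.Algebra.EuclideanLattices
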